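import Literature.Analysis.FluidPDE.FluidComputer.ThresholdTransferAngle
import Literature.Analysis.FluidPDE.FluidComputer.ThresholdDrainWindow
import HarnessLib

/-!
# Fluid computer blueprint — threshold gate: gluing the build-up to the conversion band

HONEST FRAMING: low prior, high value-of-information experiment on Tao's machine paradigm; NOT a
claim that NS blows up. Elementary estimates on forced windows of the explicit five-mode
threshold circuit; nothing is asserted about any fluid equation.

## What

The drain conversion on a forced transfer window (`IsForcedWindow`) has two phases
(`ThresholdDrainWindow`): OUTPUT BUILD-UP while the damping `κã` is weak against the rotor speed
`rc`, then PAIR-ENERGY DECAY once `κã ≥ γ₀·rc` (a band FLOOR). This file supplies the glue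
between them, exactly as in the toy model `SelfDampingRotor.exists_damping_ge_one` /
`pair_decay_after`, but with forcing and a variable rotor speed:

* `IsForcedWindow.shift` — a forced window restarted at an interior time `t₁` is a forced window
  (for `s ↦ x(t₁ + s)` on `[0, τ - t₁]`), so the time-form decay lemmas, which start at time `0`,
  apply after the build-up;
* `IsForcedWindow.output_ge_affine_from` — the output never unloads by more than the forcing from
  ANY interior time: `κã(t) ≥ κã(t₁) - κδ(t - t₁)`; hence `band_floor_of_level`: a level
  `κã(t₁) ≥ L` with `L ≥ γ₀·r·Cm + κδ(τ - t₁)` keeps the band floor `γ₀·rc ≤ κã` on `[t₁, τ)`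
  whenever `c ≤ Cm` there;
* `IsForcedWindow.exists_output_level` — THE BUILD-UP ENDS: if `c₀ ≤ c ≤ Cm` (`c₀ ≥ 0`),
  `|xᵢ| ≤ R`, `κã ≥ 0`, the pair energy is `≥ u₀ ≥ 0` on the window, the level `L` is below the
  weak-band ceiling (`L ≤ γ₁·r·c₀`, `0 ≤ γ₁ ≤ 2`) and the build-up budget at some `T_A ≤ τ` reaches
  it, `L ≤ κ·(ã(0) - K₀R² + (K₀/2)(1 - γ₁/2)u₀·(rc₀T_A) - (K₀RP + δ)T_A)` (`K₀ = κ/(rCm)`,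
  `P = εR² + σRCm + μCm² + δ`), then `κã(t₁) ≥ L` for some `t₁ ≤ T_A` — by contradiction from
  `IsForcedWindow.output_buildup` and `angle_ge_mul` (`Θ ≥ rc₀·t`).

What remains for the transfer stage as a `ReachCertificate` (HOME/pub-fluidc-bp3/NEXT-STAGES.md):
the clock side (that `c₀ ≤ c ≤ Cm` survives long enough, `trigger_le_angle` / `conduit_floor`)
and the bookkeeping that chains `exists_output_level → shift → pair_energy_decay_sharp`.
[cite: Tao2016AveragedNS, §5.5 (the energy-transfer phase of Thm 5.3)]
-/

noncomputable section

open Set Filter Topology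
open scoped NNReal

namespace Literature.Analysis.FluidPDE.FluidComputer

open Literature.Analysis.FluidPDE.Tao2016AveragedNS Literature.Analysis.ODE

variable {ε σ ν μ r κ δ τ : ℝ} {x : ℝ → Fin 5 → ℝ} {Θ : ℝ → ℝ}

namespace IsForcedWindow

/-- **Restart at an interior time.** [folklore] -/
theorem shift (h : IsForcedWindow ε σ ν μ r κ δ τ x) {t₁ : ℝ} (ht₁ : t₁ ∈ Icc 0 τ) :
    IsForcedWindow ε σ ν μ r κ δ (τ - t₁) (fun s => x (t₁ + s)) := by
  refine ⟨?_, ?_⟩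
  · have hmaps : MapsTo (fun s : ℝ => t₁ + s) (Icc 0 (τ - t₁)) (Icc 0 τ) := fun s hs =>
      ⟨by linarith [ht₁.1, hs.1], by linarith [hs.2]⟩
    exact h.continuousOn.comp (continuous_const.add continuous_id).continuousOn hmaps
  · intro s hs
    have hts : t₁ + s ∈ Ico 0 τ := ⟨by linarith [ht₁.1, hs.1], by linarith [hs.2]⟩
    obtain ⟨V, hV, hVδ⟩ := h.defect (t₁ + s) hts
    refine ⟨V, ?_, hVδ⟩
    have hg : HasDerivWithinAt (fun u : ℝ => t₁ + u) 1 (Ici s) s :=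
      (hasDerivWithinAt_id s (Ici s)).const_add t₁
    have hm : MapsTo (fun u : ℝ => t₁ + u) (Ici s) (Ici (t₁ + s)) := fun u hu => by
      have hu' : s ≤ u := hu
      show t₁ + s ≤ t₁ + u
      linarith
    have := hV.scomp s hg hm
    simpa [Function.comp_def] using this

/-- **The output never unloads by more than the forcing, from any interior time:**
`ã(t) ≥ ã(t₁) - δ(t - t₁)` for `t₁ ≤ t ≤ τ` (`κ ≥ 0`). [folklore] -/
theorem output_ge_affine_from (h : IsForcedWindow ε σ ν μ r κ δ τ x) (hκ : 0 ≤ κ) {t₁ : ℝ}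
    (ht₁ : t₁ ∈ Icc 0 τ) : ∀ t ∈ Icc t₁ τ, x t₁ 4 - δ * (t - t₁) ≤ x t 4 := by
  choose! V hV hVδ using h.defect
  have hsub : Icc t₁ τ ⊆ Icc 0 τ := Icc_subset_Icc_left ht₁.1
  have hcn : ContinuousOn (fun s => x s 4) (Icc t₁ τ) :=
    ((continuous_apply 4).comp_continuousOn h.continuousOn).mono hsub
  have hdv : ∀ s ∈ Ico t₁ τ, HasDerivWithinAt (fun s => x s 4) (V s 4) (Ici s) s :=
    fun s hs => (hasDerivWithinAt_pi.1 (hV s ⟨ht₁.1.trans hs.1, hs.2⟩)) 4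
  have hbd : ∀ s ∈ Ico t₁ τ, -δ ≤ V s 4 := by
    intro s hs
    have hs' : s ∈ Ico 0 τ := ⟨ht₁.1.trans hs.1, hs.2⟩
    have hg := abs_apply_le_of_norm_le (hVδ s hs') 4
    rw [Pi.sub_apply, thresholdCircuit_apply_four] at hg
    have h1 := (abs_le.1 hg).1
    have e1 : 0 ≤ κ * x s 3 ^ 2 := by positivity
    linarith
  intro t ht
  have := mul_le_sub_of_le_deriv_right hcn hdv hbd t ht
  linarith

/-- **A level keeps the band floor.** If `κã(t₁) ≥ L` with `L ≥ γ₀·r·Cm + κδ(τ - t₁)`, `r ≥ 0`,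
`γ₀ ≥ 0` and `c ≤ Cm` on `[t₁, τ)`, then `γ₀·(rc) ≤ κã` on `[t₁, τ)`. [folklore] -/
theorem band_floor_of_level (h : IsForcedWindow ε σ ν μ r κ δ τ x) (hκ : 0 ≤ κ) (hδ : 0 ≤ δ)
    (hr : 0 ≤ r) {t₁ L γ₀ Cm : ℝ} (ht₁ : t₁ ∈ Icc 0 τ) (hγ₀ : 0 ≤ γ₀) (hL : L ≤ κ * x t₁ 4)
    (hLfloor : γ₀ * (r * Cm) + κ * δ * (τ - t₁) ≤ L) (hc : ∀ t ∈ Ico t₁ τ, x t 2 ≤ Cm) :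
    ∀ t ∈ Ico t₁ τ, γ₀ * (r * x t 2) ≤ κ * x t 4 := by
  intro t ht
  have h1 := h.output_ge_affine_from hκ ht₁ t (Ico_subset_Icc_self ht)
  have h2 : κ * (x t₁ 4 - δ * (t - t₁)) ≤ κ * x t 4 := mul_le_mul_of_nonneg_left h1 hκ
  have h3 : γ₀ * (r * x t 2) ≤ γ₀ * (r * Cm) :=
    mul_le_mul_of_nonneg_left (mul_le_mul_of_nonneg_left (hc t ht) hr) hγ₀
  have h4 : κ * δ * (t - t₁) ≤ κ * δ * (τ - t₁) :=
    mul_le_mul_of_nonneg_left (by linarith [ht.2]) (mul_nonneg hκ hδ)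
  nlinarith [h2, h3, h4, hL, hLfloor]

/-- **The build-up ends (the output reaches a level).** See the module docstring. [folklore] -/
theorem exists_output_level (h : IsForcedWindow ε σ ν μ r κ δ τ x) (hε : 0 ≤ ε) (hσ : 0 ≤ σ)
    (hμ : 0 ≤ μ) (hr : 0 < r) (hκ : 0 ≤ κ) (hδ : 0 ≤ δ) {R Cm c₀ γ₁ u₀ L TA : ℝ} (hR : 0 ≤ R)
    (hCm : 0 < Cm) (hc₀ : 0 ≤ c₀) (hγ₁0 : 0 ≤ γ₁) (hγ₁ : γ₁ ≤ 2) (hu₀ : 0 ≤ u₀)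
    (hΘ0 : Θ 0 = 0) (hΘc : ContinuousOn Θ (Icc 0 τ))
    (hΘ' : ∀ t ∈ Ico 0 τ, HasDerivWithinAt Θ (r * x t 2) (Ici t) t)
    (hc : ∀ t ∈ Ico 0 τ, c₀ ≤ x t 2 ∧ x t 2 ≤ Cm) (hRall : ∀ t ∈ Icc 0 τ, ∀ i, |x t i| ≤ R)
    (hu : ∀ t ∈ Ico 0 τ, u₀ ≤ x t 0 ^ 2 + x t 3 ^ 2) (hout : ∀ t ∈ Ico 0 τ, 0 ≤ κ * x t 4)
    (hLceil : L ≤ γ₁ * (r * c₀)) (hTA : TA ∈ Icc 0 τ)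
    (hreach : L ≤ κ * (x 0 4 - κ / (r * Cm) * R ^ 2 +
      κ / (r * Cm) / 2 * ((1 - γ₁ / 2) * u₀) * (r * c₀ * TA) -
      (κ / (r * Cm) * R * (ε * R ^ 2 + σ * R * Cm + μ * Cm ^ 2 + δ) + δ) * TA)) :
    ∃ t₁ ∈ Icc 0 TA, L ≤ κ * x t₁ 4 := by
  by_contra hcon
  simp only [not_exists, not_and, not_le] at hcon
  -- the restricted window `[0, TA]`
  have hW := h.mono hTA.2
  have hIco : ∀ t ∈ Ico 0 TA, t ∈ Ico 0 τ := fun t ht => ⟨ht.1, lt_of_lt_of_le ht.2 hTA.2⟩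
  have hIcc : ∀ t ∈ Icc 0 TA, t ∈ Icc 0 τ := fun t ht => ⟨ht.1, ht.2.trans hTA.2⟩
  have hband : ∀ t ∈ Ico 0 TA, 0 ≤ κ * x t 4 ∧ κ * x t 4 ≤ γ₁ * (r * x t 2) := by
    intro t ht
    refine ⟨hout t (hIco t ht), ?_⟩
    have h1 : κ * x t 4 < L := hcon t (Ico_subset_Icc_self ht)
    have h2 : γ₁ * (r * c₀) ≤ γ₁ * (r * x t 2) :=
      mul_le_mul_of_nonneg_left (mul_le_mul_of_nonneg_left (hc t (hIco t ht)).1 hr.le) hγ₁0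
    linarith
  have hmain := hW.output_buildup hε hσ hμ hr hκ hδ hR hCm hγ₁ hΘ0
    (hΘc.mono (Icc_subset_Icc_right hTA.2)) (fun t ht => hΘ' t (hIco t ht))
    (fun t ht => ⟨hc₀.trans (hc t (hIco t ht)).1, (hc t (hIco t ht)).2⟩)
    (fun t ht => hRall t (hIcc t ht)) (fun t ht => hu t (hIco t ht)) hband TA
    ⟨hTA.1, le_rfl⟩
  -- `Θ(TA) ≥ r c₀ TA`
  have hang := angle_ge_mul hr.le hΘ0 hΘc hΘ' (fun t ht => (hc t ht).1) TA hTA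
  have hcoef : 0 ≤ κ / (r * Cm) / 2 * ((1 - γ₁ / 2) * u₀) := by
    have : 0 ≤ 1 - γ₁ / 2 := by linarith
    positivity
  have hmono := mul_le_mul_of_nonneg_left hang hcoef
  have hlt : κ * x TA 4 < L := hcon TA ⟨hTA.1, le_rfl⟩
  have hk : κ * (x 0 4 - κ / (r * Cm) * R ^ 2 +
      κ / (r * Cm) / 2 * ((1 - γ₁ / 2) * u₀) * Θ TA -
      (κ / (r * Cm) * R * (ε * R ^ 2 + σ * R * Cm + μ * Cm ^ 2 + δ) + δ) * TA) ≤ κ * x TA 4 :=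
    mul_le_mul_of_nonneg_left hmain hκ
  have hk2 : κ * (x 0 4 - κ / (r * Cm) * R ^ 2 +
      κ / (r * Cm) / 2 * ((1 - γ₁ / 2) * u₀) * (r * c₀ * TA) -
      (κ / (r * Cm) * R * (ε * R ^ 2 + σ * R * Cm + μ * Cm ^ 2 + δ) + δ) * TA) ≤
      κ * (x 0 4 - κ / (r * Cm) * R ^ 2 +
      κ / (r * Cm) / 2 * ((1 - γ₁ / 2) * u₀) * Θ TA -
      (κ / (r * Cm) * R * (ε * R ^ 2 + σ * R * Cm + μ * Cm ^ 2 + δ) + δ) * TA) :=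
    mul_le_mul_of_nonneg_left (by linarith [hmono]) hκ
  linarith [hreach, hk, hk2, hlt]

end IsForcedWindow

end Literature.Analysis.FluidPDE.FluidComputer

end
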